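import Literature.AlgebraicGeometry.Motives.UniversalHypersurfaceRegularLocusChartTarget
import Literature.Geometry.ComplexAnalytic.PhamBrieskornWeightedRotation
import HarnessLib

/-!
# The model isotopy of the nodal pencil on the regular locus (definition and chart description)

Family `hodge`, layer `Literature/AlgebraicGeometry/HodgeTheory`; step A3b (first part) of the programme discharging
`HodgeTheory/CyclicCoverNodalMeridianLocalMonodromyBound`. In the chart `Φᵢ = regChartFun n d i` of `𝒴°(ℂ)ᵢ` (coordinates `(b', y)`), the MODEL
ISOTOPY moves the affine coordinates by the weighted rotation read through a Morse chart `Θ` of the affine space,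
`y ↦ Θ⁻¹(R_θ Θ y)` (`Geometry/ComplexAnalytic/PhamBrieskornWeightedRotation`), and keeps `b'`:
`J(θ, x) = Φᵢ⁻¹(b'(x), Θ⁻¹ R_θ Θ (y(x)))` for `x` in the chart domain (and `J(θ, x) = x` outside). When the solved form at the rotated
coordinates is nonsingular, the rotated coordinate vector IS attained (`UniversalHypersurfaceRegularLocusChartTarget`), so `J(θ, x)` lies in
the chart domain and has exactly these chart coordinates.

* `chartModelIsotopy` — the definition (for any chart-like open partial homeomorphism `Φ` and Morse chart `Θ`, weights `a`);
* `chartModelIsotopy_of_not_mem` — outside the source it is the identity;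
* `chartModelIsotopy_mem_and_apply` — **inside, under the nonsingularity hypothesis: `J(θ,x) ∈ Φ.source` and `Φ (J(θ,x)) = (b'(x), Θ⁻¹ R_θ Θ y(x))`.**

Everything is proved; the one definition is concrete; no named facts.

## References

* [Milnor1968] J. Milnor, Singular Points of Complex Hypersurfaces (1968), §9 Lemma 9.4.
* [ArnoldGuseinzadeVarchenko2012] V. I. Arnold, S. M. Gusein-Zade, A. N. Varchenko, Singularities of Differentiable Maps II (2012), Part I §2.3.
-/

noncomputable section

open MvPolynomial Set Function Complex
open Literature.AlgebraicGeometry.Motives Literature.AlgebraicGeometry.Motives.UniversalHypersurface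
open Literature.Geometry.ComplexAnalytic

namespace Literature.AlgebraicGeometry.HodgeTheory

variable {n d : ℕ} {i : Fin (n + 2)} (a : Fin (n + 1) → ℕ)
  (Φ : OpenPartialHomeomorph (ComplexPoints (regularTotal ℂ n d)) (({m : DegIndex n d // m ≠ regPowIndex n d i} ⊕ Fin (n + 1)) → ℂ))
  (Θ : OpenPartialHomeomorph (Fin (n + 1) → ℂ) (Fin (n + 1) → ℂ))

open scoped Classical in
/-- **The model isotopy in the chart**: `J(θ, x) = Φ⁻¹(b'(x), Θ⁻¹(R_θ Θ y(x)))` on `Φ.source`, `x` elsewhere.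
[cite: Milnor1968, §9 Lemma 9.4] [cite: ArnoldGuseinzadeVarchenko2012, Part I §2.3] -/
def chartModelIsotopy (θ : ℝ) (x : ComplexPoints (regularTotal ℂ n d)) : ComplexPoints (regularTotal ℂ n d) :=
  if x ∈ Φ.source then
    Φ.symm (Sum.elim (fun m => Φ x (Sum.inl m))
      (Θ.symm (fun k => Complex.exp (((θ / a k : ℝ) : ℂ) * I) * Θ (fun j => Φ x (Sum.inr j)) k)))
  else x

/-- Outside the chart source the model isotopy is the identity. [cite: Milnor1968, §9 Lemma 9.4] -/
theorem chartModelIsotopy_of_not_mem {θ : ℝ} {x : ComplexPoints (regularTotal ℂ n d)} (hx : x ∉ Φ.source) :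
    chartModelIsotopy a Φ Θ θ x = x := by
  classical
  simp [chartModelIsotopy, hx]

/-- Inside the chart source the model isotopy is the chart pull-back of `(b', Θ⁻¹ R_θ Θ y)`. [cite: Milnor1968, §9 Lemma 9.4] -/
theorem chartModelIsotopy_of_mem {θ : ℝ} {x : ComplexPoints (regularTotal ℂ n d)} (hx : x ∈ Φ.source) :
    chartModelIsotopy a Φ Θ θ x =
      Φ.symm (Sum.elim (fun m => Φ x (Sum.inl m))
        (Θ.symm (fun k => Complex.exp (((θ / a k : ℝ) : ℂ) * I) * Θ (fun j => Φ x (Sum.inr j)) k))) := by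
  classical
  simp [chartModelIsotopy, hx]

/-- **Chart description of the model isotopy.** If the target of `Φ` is the image `regChartFun '' regChartDom` (as for the chart of
`UniversalHypersurfaceRegularLocusChart.exists_regChart`), `d ≥ 1`,
and the solved form at the rotated coordinate vector `v' = (b'(x), Θ⁻¹ R_θ Θ y(x))` is nonsingular, then `J(θ, x)` lies in the chart domain and
`Φ (J(θ, x)) = v'`. [cite: Milnor1968, §9 Lemma 9.4] [cite: ArnoldGuseinzadeVarchenko2012, Part I §2.3] -/
theorem chartModelIsotopy_mem_and_apply (hd : 0 < d)
    (hΦt : Φ.target = regChartFun n d i '' regChartDom n d i)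
    {θ : ℝ} {x : ComplexPoints (regularTotal ℂ n d)} (hx : x ∈ Φ.source)
    (hns : SmoothHypersurface.IsNonsingularForm ℂ (formOfCoeffs (regChartCoeffVec n d i
      (Sum.elim (fun m => Φ x (Sum.inl m))
        (Θ.symm (fun k => Complex.exp (((θ / a k : ℝ) : ℂ) * I) * Θ (fun j => Φ x (Sum.inr j)) k)))))) :
    chartModelIsotopy a Φ Θ θ x ∈ Φ.source ∧
      Φ (chartModelIsotopy a Φ Θ θ x) =
        Sum.elim (fun m => Φ x (Sum.inl m))
          (Θ.symm (fun k => Complex.exp (((θ / a k : ℝ) : ℂ) * I) * Θ (fun j => Φ x (Sum.inr j)) k)) := by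
  have hmem : (Sum.elim (fun m => Φ x (Sum.inl m))
      (Θ.symm (fun k => Complex.exp (((θ / a k : ℝ) : ℂ) * I) * Θ (fun j => Φ x (Sum.inr j)) k)) :
        ({m : DegIndex n d // m ≠ regPowIndex n d i} ⊕ Fin (n + 1)) → ℂ) ∈ Φ.target := by
    rw [hΦt]
    exact mem_image_regChartFun_of_nonsingular n d i hd _ hns
  rw [chartModelIsotopy_of_mem a Φ Θ hx]
  exact ⟨Φ.map_target hmem, Φ.right_inv hmem⟩

end Literature.AlgebraicGeometry.HodgeTheory

end
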